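import Summits.QuantumAdvantage.QuantumAdvantage.Theorems.OddPrimeWalkBlindPairLaw
import Summits.QuantumAdvantage.QuantumAdvantage.Theorems.OddPrimeWalkTripleCount

/-!
# Zero-sum pairs of near parts and far parts; transport to the cubes (engine for item stmt-QuantumAdvantage-24030 `FarAffinePairLaw`)

Cell qa-qnc0, route OddPrimeWalk; prover qn-prover-3 g18 (planner qa-qnc0-p2 g29 ROUND-29 §4.4).

§1 `zsumA n m a` / `zsumB n m b`: ordered pairs `(x, y)` of `A`-parts (supported below the separator `m`) resp. `B`-parts with
`x, y, x ⊕ y` in class `a` resp. `b`; the restriction / extension-by-zero bijections with the cubes `{0,1}^m`, `{0,1}^(n−m)`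
(`resA/extA`, `resB/extB`: additive, weight-preserving) give `|zsumA n m a| = |zsum m a|`, `|zsumB n m b| = |zsum (n−m) b|`
(`card_zsumA`, `card_zsumB`), so the cube count `three_mul_sq_card_cls_le` applies to both sides.  §2 small tools for the slot
configuration `OddConfig.tri`: `tri_pred`, `sum_tri`, and `addV_addV_cancel`.
WHAT THIS IS NOT: bookkeeping; separation NOT moved.
-/

namespace Summit.QuantumAdvantage.AdviceFreeQNC0.OddConfig

open Finset Classical

variable {n : ℕ}

/-! ### §1 Zero-sum pairs of near parts and of far parts; transport to the cubes -/

/-- zero-sum pairs of `A`-parts of class `a`: `(x, y)` with `x, y, x ⊕ y ∈ Acl n m a`. -/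
def zsumA (n m a : ℕ) : Finset ((Fin n → Bool) × (Fin n → Bool)) :=
  ((Acl n m a) ×ˢ (Acl n m a)).filter fun p => addV p.1 p.2 ∈ Acl n m a

/-- zero-sum pairs of `B`-parts of class `b`. -/
def zsumB (n m b : ℕ) : Finset ((Fin n → Bool) × (Fin n → Bool)) :=
  ((Bcl n m b) ×ˢ (Bcl n m b)).filter fun p => addV p.1 p.2 ∈ Bcl n m b

section Transport

variable {m : ℕ}

/-- restriction of an input to the near cube `{0,1}^m`. -/
def resA (hm : m ≤ n) (s : Fin n → Bool) : Fin m → Bool := fun j => s (Fin.castLE hm j)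

/-- extension by zero from the near cube. -/
def extA (m : ℕ) (v : Fin m → Bool) : Fin n → Bool := fun i => if h : i.val < m then v ⟨i.val, h⟩ else false

/-- restriction of an input to the far cube `{0,1}^(n-m)`. -/
def resB (m : ℕ) (t : Fin n → Bool) : Fin (n - m) → Bool := fun j => t ⟨m + j.val, by have := j.isLt; omega⟩

/-- extension by zero from the far cube. -/
def extB (m : ℕ) (v : Fin (n - m) → Bool) : Fin n → Bool :=
  fun i => if h : m ≤ i.val then v ⟨i.val - m, by have := i.isLt; omega⟩ else false

/-- `resA` is additive. -/
theorem resA_addV (hm : m ≤ n) (s t : Fin n → Bool) : resA hm (addV s t) = addV (resA hm s) (resA hm t) := rfl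

/-- the near weight is the weight of the restriction. -/
theorem wt_resA (hm : m ≤ n) (s : Fin n → Bool) : wt (resA hm s) = wtA m s := (wtA_eq_wt_restrict hm s).symm

/-- `extA` lands in the `A`-parts. -/
theorem extA_mem_Aset (v : Fin m → Bool) : extA (n := n) m v ∈ Aset n m :=
  mem_filter.mpr ⟨mem_univ _, fun i hi => by simp [extA, hi]⟩

/-- `resA ∘ extA = id`. -/
theorem resA_extA (hm : m ≤ n) (v : Fin m → Bool) : resA hm (extA m v) = v := by
  funext j; simp [resA, extA, Fin.castLE, j.isLt]

/-- `extA ∘ resA = id` on `A`-parts. -/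
theorem extA_resA (hm : m ≤ n) {s : Fin n → Bool} (hs : s ∈ Aset n m) : extA m (resA hm s) = s := by
  funext i
  by_cases h : i.val < m
  · simp only [extA, h, dif_pos]; rfl
  · simp only [extA, h, dif_neg, not_false_eq_true]; exact ((mem_filter.mp hs).2 i h).symm

/-- `extA` is additive. -/
theorem extA_addV (v w : Fin m → Bool) : extA (n := n) m (addV v w) = addV (extA m v) (extA m w) := by
  funext i; by_cases h : i.val < m <;> simp [extA, addV, h]

/-- membership transport for classes, near side. -/
theorem resA_mem_cls (hm : m ≤ n) {a : ℕ} {s : Fin n → Bool} (hs : s ∈ Acl n m a) : resA hm s ∈ cls m a := by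
  rw [cls, mem_filter, wt_resA hm]; exact ⟨mem_univ _, (mem_filter.mp hs).2⟩

/-- membership transport for classes, near side, converse direction. -/
theorem extA_mem_Acl (hm : m ≤ n) {a : ℕ} {v : Fin m → Bool} (hv : v ∈ cls m a) : extA m v ∈ Acl n m a := by
  refine mem_filter.mpr ⟨extA_mem_Aset v, ?_⟩
  rw [← wt_resA hm, resA_extA hm]; exact (mem_filter.mp hv).2

/-- **transport of the zero-sum pair count, near side**: `|zsumA n m a| = |zsum m a|`. -/
theorem card_zsumA (hm : m ≤ n) (a : ℕ) : (zsumA n m a).card = (zsum m a).card := by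
  refine card_nbij' (fun p => (resA hm p.1, resA hm p.2)) (fun q => (extA m q.1, extA m q.2)) ?_ ?_ ?_ ?_
  · intro p hp
    have hp' := mem_filter.mp (mem_coe.mp hp)
    obtain ⟨h1, h2⟩ := mem_product.mp hp'.1
    rw [mem_coe, zsum, mem_filter, mem_product]
    exact ⟨⟨resA_mem_cls hm h1, resA_mem_cls hm h2⟩, by
      rw [← resA_addV hm]; exact resA_mem_cls hm hp'.2⟩
  · intro q hq
    have hq' := mem_filter.mp (mem_coe.mp hq)
    obtain ⟨h1, h2⟩ := mem_product.mp hq'.1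
    rw [mem_coe, zsumA, mem_filter, mem_product]
    refine ⟨⟨extA_mem_Acl hm h1, extA_mem_Acl hm h2⟩, ?_⟩
    rw [← extA_addV]; exact extA_mem_Acl hm hq'.2
  · intro p hp
    have hp' := mem_filter.mp (mem_coe.mp hp)
    obtain ⟨h1, h2⟩ := mem_product.mp hp'.1
    exact Prod.ext (extA_resA hm (mem_filter.mp h1).1) (extA_resA hm (mem_filter.mp h2).1)
  · intro q _
    exact Prod.ext (resA_extA hm q.1) (resA_extA hm q.2)

/-- `resB` is additive. -/
theorem resB_addV (s t : Fin n → Bool) : resB m (addV s t) = addV (resB m s) (resB m t) := rfl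

/-- the far weight is the weight of the restriction. -/
theorem wt_resB (hm : m ≤ n) (t : Fin n → Bool) : wt (resB m t) = wtB m t := (wtB_eq_wt_restrict hm t).symm

/-- `extB` lands in the `B`-parts. -/
theorem extB_mem_Bset (v : Fin (n - m) → Bool) : extB (n := n) m v ∈ Bset n m :=
  mem_filter.mpr ⟨mem_univ _, fun i hi => by
    have : ¬ m ≤ i.val := by omega
    simp [extB, this]⟩

/-- `resB ∘ extB = id`. -/
theorem resB_extB (v : Fin (n - m) → Bool) : resB m (extB (n := n) m v) = v := by
  funext j; simp [resB, extB]

/-- `extB ∘ resB = id` on `B`-parts. -/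
theorem extB_resB {t : Fin n → Bool} (ht : t ∈ Bset n m) : extB m (resB m t) = t := by
  funext i
  by_cases h : m ≤ i.val
  · simp only [extB, h, dif_pos, resB]
    congr 1; exact Fin.ext (by simp only; omega)
  · simp only [extB, h, dif_neg, not_false_eq_true]; exact ((mem_filter.mp ht).2 i (by omega)).symm

/-- `extB` is additive. -/
theorem extB_addV (v w : Fin (n - m) → Bool) :
    extB (n := n) m (addV v w) = addV (extB m v) (extB m w) := by
  funext i; by_cases h : m ≤ i.val <;> simp [extB, addV, h]

/-- membership transport for classes, far side. -/
theorem resB_mem_cls (hm : m ≤ n) {b : ℕ} {t : Fin n → Bool} (ht : t ∈ Bcl n m b) :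
    resB m t ∈ cls (n - m) b := by
  rw [cls, mem_filter, wt_resB hm]; exact ⟨mem_univ _, (mem_filter.mp ht).2⟩

/-- membership transport for classes, far side, converse direction. -/
theorem extB_mem_Bcl (hm : m ≤ n) {b : ℕ} {v : Fin (n - m) → Bool} (hv : v ∈ cls (n - m) b) :
    extB m v ∈ Bcl n m b := by
  refine mem_filter.mpr ⟨extB_mem_Bset v, ?_⟩
  rw [← wt_resB hm, resB_extB]; exact (mem_filter.mp hv).2

/-- **transport of the zero-sum pair count, far side**: `|zsumB n m b| = |zsum (n-m) b|`. -/
theorem card_zsumB (hm : m ≤ n) (b : ℕ) : (zsumB n m b).card = (zsum (n - m) b).card := by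
  refine card_nbij' (fun p => (resB m p.1, resB m p.2)) (fun q => (extB m q.1, extB m q.2)) ?_ ?_ ?_ ?_
  · intro p hp
    have hp' := mem_filter.mp (mem_coe.mp hp)
    obtain ⟨h1, h2⟩ := mem_product.mp hp'.1
    rw [mem_coe, zsum, mem_filter, mem_product]
    exact ⟨⟨resB_mem_cls hm h1, resB_mem_cls hm h2⟩, by
      rw [← resB_addV]; exact resB_mem_cls hm hp'.2⟩
  · intro q hq
    have hq' := mem_filter.mp (mem_coe.mp hq)
    obtain ⟨h1, h2⟩ := mem_product.mp hq'.1
    rw [mem_coe, zsumB, mem_filter, mem_product]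
    refine ⟨⟨extB_mem_Bcl hm h1, extB_mem_Bcl hm h2⟩, ?_⟩
    rw [← extB_addV]; exact extB_mem_Bcl hm hq'.2
  · intro p hp
    have hp' := mem_filter.mp (mem_coe.mp hp)
    obtain ⟨h1, h2⟩ := mem_product.mp hp'.1
    exact Prod.ext (extB_resB (mem_filter.mp h1).1) (extB_resB (mem_filter.mp h2).1)
  · intro q _
    exact Prod.ext (resB_extB q.1) (resB_extB q.2)

end Transport

/-! ### §2 The triple versions of the two pigeonholes -/

/-- cancellation: `x ⊕ (x ⊕ y) = y`. -/
theorem addV_addV_cancel (x y : Fin n → Bool) : addV x (addV x y) = y := by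
  rw [← addV_assoc, addV_self, addV_comm, addV_zeroV]

/-- a predicate holding at `x b`, `y b`, `x b ⊕ y b` holds at every slot of `tri x y`. -/
theorem tri_pred (P : (Fin n → Bool) → Prop) (x y : Fin 3 → Fin n → Bool) (j : Fin 3 × Fin 3)
    (h0 : P (x j.1)) (h1 : P (y j.1)) (h2 : P (addV (x j.1) (y j.1))) : P (tri x y j) := by
  obtain ⟨b, t⟩ := j
  fin_cases t
  · simpa [tri] using h0
  · simpa [tri] using h1
  · simpa [tri] using h2

/-- a sum over the nine slots of `tri x y` is the sum over classes of the three slot values. -/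
theorem sum_tri (F : (Fin n → Bool) → ℝ) (x y : Fin 3 → Fin n → Bool) :
    (∑ j : Fin 3 × Fin 3, F (tri x y j)) = ∑ a : Fin 3, (F (x a) + F (y a) + F (addV (x a) (y a))) := by
  rw [Fintype.sum_prod_type]
  refine sum_congr rfl fun a _ => ?_
  rw [Fin.sum_univ_three, tri_zero, tri_one, tri_two]

end Summit.QuantumAdvantage.AdviceFreeQNC0.OddConfig
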